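import Literature.NumberTheory.DiophantineGeometry.PlaneCurveFiniteFibres
import Mathlib.FieldTheory.IntermediateField.Adjoin.Basic
import Mathlib.RingTheory.Algebraic.Integral
import Mathlib.FieldTheory.IsAlgClosed.Basic

/-!
# [GenEll] Thm 2.1 for `ℙ¹` (route piece W5-F): the fibres `t⁻¹(b)` on `D_e : r^e = x(1−x)` are
# finite sets of algebraic points — `E_φ = t⁻¹(B)` and `X_φ = x(E_φ)` as `Finset`s

Support file for the cell's number-field-only proof architecture of `GenEllTwo` (stmt-ABC-19679;
S. Mochizuki, *Arithmetic elliptic curves in general position*, Math. J. Okayama Univ. **52**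
(2010), Thm. 2.1 (ii) ⇒ (i), proof pp. 12–13; package map `GENELLTWO-P1ROUTE.md` of seat
abc-iut-S6, §2 (B), §4 («`X_φ := x(E_φ) ⊂ U(ℚ̄)` finite, NO cusps»), work package W5-F assigned to
this seat by S6 OWNER DECISIONS #2 (D2), 2026-08-26).

Conventions (those of L6-t16's W4a / S6 (D3)): `e = 2k+1`, affine coordinates `z = (x, r)` with
`r^e = x(1−x)`, `s := 1 − 2x`, `T := s + r^{k+2}`, `t := T/(r·s)`.  Away from the poles of `t`
(`r = 0`: `Q_0, Q_1`; `s = 0`: the Weierstrass points `W`) one has `t − b = D_b/(r s)` with the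
POLYNOMIAL numerator `D_b(x, r) := (1 − 2x) + r^{k+2} − b·r·(1 − 2x)`, and `D_b` does not vanish at
any pole (`D_b = s = ±1` at `r = 0`, `D_b = r^{k+2} ≠ 0` at `s = 0`).  Hence, as SETS of affine points
of the curve, `t⁻¹(b) = V(D_b)`.  Contents:

* `curvePoly k = Y^{2k+1} − C(x(1−x))`, `fibrePoly k b = Y^{k+2} − C(b(1−2x))·Y + C(1−2x)` in
  `K[x][Y]` with their evaluation lemmas; `irreducible_curvePoly` (Eisenstein at `x`),
  `not_dvd_fibrePoly` (specialise `x = 0`: `Y^{2k+1} ∤ Y^{k+2} − bY + 1`);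
* `fibre_finite`: for every field `F` and `b ∈ F`, `{z ∈ F² : z on D_e, D_b(z) = 0}` is finite
  (`PlaneCurve.finite_commonZeros`); `fibre_iff_t`: on the curve, `D_b(z) = 0 ↔ r ≠ 0 ∧ s ≠ 0 ∧
  t(z) = b`;
* `Ephi k B : Finset (F × F)` (`= t⁻¹(B)`), `Xphi k B : Finset F` (`= x(E_φ)`), membership lemmas,
  and `zero_not_mem_Xphi`, `one_not_mem_Xphi` («no cusps»);
* ALGEBRAICITY: `isAlgebraic_of_mem_fibre` — over a `K`-field `F`, a point of the fibre over
  `b ∈ K` has both coordinates algebraic over `K` (the `x`-coordinate is a root of the nonzero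
  resultant, `r` of `Y^e − x(1−x)`); `exists_intermediateField_finiteDimensional` — all coordinates
  of `E_φ` lie in ONE intermediate field finite-dimensional over `K` (a number field when `K` is);
* FUNCTORIALITY under field homomorphisms: `map_mem_fibre_iff`.

Classical and undisputed; nothing here bears on [IUTchIII] Cor. 3.12.
-/

namespace Literature.NumberTheory.DiophantineGeometry.GenEll.De

open Polynomial

universe u v w

section Polys

variable {K : Type u} [Field K] {F : Type v} [Field F] [Algebra K F]

/-- The affine equation of the cyclic cover `D_e : r^e = x(1−x)`, `e = 2k+1`, as a polynomial in
`Y = r` over `K[x]`: `Y^{2k+1} − C(x(1−x))`.  (GENELLTWO-P1ROUTE §2 (A): «`D_e : r^e = x(1−x)` (e odd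
≥ 5): the cyclic degree-e cover of `ℙ¹_x`, totally ramified over exactly `0, 1, ∞`».)
[cite: MochizukiGenEll2010, Thm 2.1 proof p.12 (the ramified cover `Y → X` over `D`), P1ROUTE §2 (A)] -/
noncomputable def curvePoly (k : ℕ) : K[X][X] := X ^ (2 * k + 1) - C (X * (1 - X))

/-- The numerator `D_b(x, Y) = Y^{k+2} − b(1−2x)·Y + (1−2x)` of `t − b`, `t = (s + r^{k+2})/(r s)`,
`s = 1 − 2x`, as a polynomial in `Y = r` over `K[x]`.  (GENELLTWO-P1ROUTE §2 (B): «`t := 1/r +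
r^{(e+1)/2}/s` … simple poles exactly at `Q_0, Q_1, Q_∞` and the `e` Weierstrass points».)
[cite: MochizukiGenEll2010, Thm 2.1 proof p.12 (noncritical Belyi map), P1ROUTE §2 (B)] -/
noncomputable def fibrePoly (k : ℕ) (b : K) : K[X][X] :=
  X ^ (k + 2) - C (C b * (1 - 2 * X)) * X + C (1 - 2 * X)

/-- `curvePoly` evaluated at the `F`-point `(x, r)`: `r^{2k+1} − x(1−x)`.
[cite: MochizukiGenEll2010, Thm 2.1 proof p.12, P1ROUTE §2 (A)] -/
theorem eval_curvePoly (k : ℕ) (x r : F) :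
    ((curvePoly (K := K) k).map (aeval x).toRingHom).eval r = r ^ (2 * k + 1) - x * (1 - x) := by
  simp [curvePoly, Polynomial.map_sub, Polynomial.map_pow]

/-- `fibrePoly` evaluated at the `F`-point `(x, r)`: `r^{k+2} − b(1−2x)·r + (1−2x)`.
[cite: MochizukiGenEll2010, Thm 2.1 proof p.12, P1ROUTE §2 (B)] -/
theorem eval_fibrePoly (k : ℕ) (b : K) (x r : F) :
    ((fibrePoly k b).map (aeval x).toRingHom).eval r =
      r ^ (k + 2) - algebraMap K F b * (1 - 2 * x) * r + (1 - 2 * x) := by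
  simp [fibrePoly, Polynomial.map_sub, Polynomial.map_pow, Polynomial.map_mul, map_ofNat]

/-- `curvePoly k` is monic of degree `2k+1`. [cite: MochizukiGenEll2010, Thm 2.1 proof p.12, P1ROUTE §2 (A)] -/
theorem monic_curvePoly (k : ℕ) : (curvePoly (K := K) k).Monic :=
  monic_X_pow_sub_C _ (by omega)

/-- `natDegree (curvePoly k) = 2k + 1`. [cite: MochizukiGenEll2010, Thm 2.1 proof p.12, P1ROUTE §2 (A)] -/
theorem natDegree_curvePoly (k : ℕ) : (curvePoly (K := K) k).natDegree = 2 * k + 1 :=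
  natDegree_X_pow_sub_C

/-- `D_e` is irreducible: `Y^{2k+1} − x(1−x)` is an Eisenstein polynomial at the prime `x` of `K[x]`.
[cite: MochizukiGenEll2010, Thm 2.1 proof p.12, P1ROUTE §2 (A)] -/
theorem irreducible_curvePoly (k : ℕ) : Irreducible (curvePoly (K := K) k) :=
  PlaneCurve.irreducible_X_pow_sub_C_X_mul_one_sub_X (2 * k + 1) (by omega)

/-- `curvePoly ∤ fibrePoly`: specialising `x = 0` would give `Y^{2k+1} ∣ Y^{k+2} − b·Y + 1`, but
the right-hand side has constant term `1`. [cite: MochizukiGenEll2010, Thm 2.1 proof p.12, P1ROUTE §2 (B)] -/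
theorem not_dvd_fibrePoly (k : ℕ) (b : K) : ¬ curvePoly k ∣ fibrePoly k b := by
  intro h
  have h0 := Polynomial.map_dvd (evalRingHom (0 : K)) h
  have hc : (curvePoly (K := K) k).map (evalRingHom 0) = X ^ (2 * k + 1) := by
    simp [curvePoly, Polynomial.map_sub, Polynomial.map_pow]
  have hX : (X : K[X]) ∣ (fibrePoly k b).map (evalRingHom 0) :=
    (dvd_pow_self X (by omega)).trans (hc ▸ h0)
  rw [X_dvd_iff] at hX
  simp [fibrePoly, Polynomial.map_sub, Polynomial.map_pow, Polynomial.map_mul, coeff_X,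
    coeff_C] at hX

/-- The images of `curvePoly` and `fibrePoly` in `K(x)[Y]` are coprime (Gauss's lemma).
[cite: MochizukiGenEll2010, Thm 2.1 proof p.12, P1ROUTE §2 (B)] -/
theorem isCoprime_curvePoly_fibrePoly (k : ℕ) (b : K) :
    IsCoprime ((curvePoly k).map (algebraMap K[X] (RatFunc K)))
      ((fibrePoly k b).map (algebraMap K[X] (RatFunc K))) :=
  PlaneCurve.isCoprime_map_of_irreducible _ _ (monic_curvePoly k) (irreducible_curvePoly k)
    (not_dvd_fibrePoly k b)

end Polys

/-! ### Finiteness of the fibres and the finite sets `E_φ`, `X_φ` -/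

section Fibres

variable {F : Type v} [Field F]

/-- **The fibre `t⁻¹(b)` on `D_e` is finite**: for every field `F` and `b ∈ F`, the set of
`z = (x, r) ∈ F²` with `r^{2k+1} = x(1−x)` and `D_b(z) = r^{k+2} − b(1−2x)r + (1−2x) = 0` is finite
(elimination: `PlaneCurve.finite_commonZeros`).  [cite: MochizukiGenEll2010, Thm 2.1 proof p.12, P1ROUTE §4 (X_φ finite)] -/
theorem fibre_finite (k : ℕ) (b : F) :
    Set.Finite {z : F × F | z.2 ^ (2 * k + 1) = z.1 * (1 - z.1) ∧
      z.2 ^ (k + 2) - b * (1 - 2 * z.1) * z.2 + (1 - 2 * z.1) = 0} := by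
  have h := PlaneCurve.finite_commonZeros (Ω := F) (curvePoly (K := F) k) (fibrePoly k b)
    (monic_curvePoly k) (by rw [natDegree_curvePoly]; omega) (isCoprime_curvePoly_fibrePoly k b)
  refine h.subset fun z hz => ?_
  obtain ⟨h1, h2⟩ := hz
  refine ⟨?_, ?_⟩
  · rw [eval_curvePoly, sub_eq_zero]; exact h1
  · rw [eval_fibrePoly]; simpa using h2

/-- On the curve, `D_b(z) = 0` iff `z` is not a pole of `t` and `t(z) = b`, where
`t(x, r) = ((1−2x) + r^{k+2}) / (r·(1−2x))`: the numerator `D_b` does not vanish at the poles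
(`r = 0 ⇒ x(1−x) = 0 ⇒ 1 − 2x = ±1`; `1 − 2x = 0 ⇒ D_b = r^{k+2}` with `r ≠ 0`).
[cite: MochizukiGenEll2010, Thm 2.1 proof p.12, P1ROUTE §2 (B) (poles of t)] -/
theorem fibre_iff_t (k : ℕ) (b : F) (z : F × F) (hz : z.2 ^ (2 * k + 1) = z.1 * (1 - z.1)) :
    z.2 ^ (k + 2) - b * (1 - 2 * z.1) * z.2 + (1 - 2 * z.1) = 0 ↔
      z.2 ≠ 0 ∧ 1 - 2 * z.1 ≠ 0 ∧ ((1 - 2 * z.1) + z.2 ^ (k + 2)) / (z.2 * (1 - 2 * z.1)) = b := by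
  constructor
  · intro h
    have hr : z.2 ≠ 0 := by
      intro hr
      have hz' : z.1 * (1 - z.1) = 0 := by
        rw [← hz, hr]; exact zero_pow (by omega : 2 * k + 1 ≠ 0)
      have h' : 1 - 2 * z.1 = 0 := by
        simpa [hr, zero_pow (by omega : k + 2 ≠ 0)] using h
      -- `x(1−x) = 0` and `1 − 2x = 0`: impossible
      rcases mul_eq_zero.mp hz' with hx | hx
      · rw [hx] at h'; norm_num at h'
      · rw [sub_eq_zero] at hx; rw [← hx] at h'; norm_num at h'
    have hs : 1 - 2 * z.1 ≠ 0 := by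
      intro hs
      rw [hs, mul_zero, zero_mul, sub_zero, add_zero] at h
      exact hr ((pow_eq_zero_iff (by omega : k + 2 ≠ 0)).mp h)
    refine ⟨hr, hs, ?_⟩
    rw [div_eq_iff (mul_ne_zero hr hs)]
    linear_combination h
  · rintro ⟨hr, hs, ht⟩
    rw [div_eq_iff (mul_ne_zero hr hs)] at ht
    linear_combination ht

/-- `E_φ := t⁻¹(B)`, the finite set of affine points of `D_e` lying over the finite set `B` under
`t` (GENELLTWO-P1ROUTE §3/§4: `E_φ := φ⁻¹{0,1,∞} = t⁻¹(B)`, `B := β⁻¹{0,1,∞}`), as a `Finset`.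
[cite: MochizukiGenEll2010, Thm 2.1 proof p.12 (E := supp φ⁻¹), P1ROUTE §4] -/
noncomputable def Ephi (k : ℕ) (B : Finset F) : Finset (F × F) :=
  ((B.finite_toSet.biUnion fun b _ => fibre_finite k b).toFinset)

/-- Membership in `E_φ`: `z` lies on `D_e` and `D_b(z) = 0` for some `b ∈ B`.
[cite: MochizukiGenEll2010, Thm 2.1 proof p.12, P1ROUTE §4] -/
theorem mem_Ephi {k : ℕ} {B : Finset F} {z : F × F} :
    z ∈ Ephi k B ↔ z.2 ^ (2 * k + 1) = z.1 * (1 - z.1) ∧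
      ∃ b ∈ B, z.2 ^ (k + 2) - b * (1 - 2 * z.1) * z.2 + (1 - 2 * z.1) = 0 := by
  simp only [Ephi, Set.Finite.mem_toFinset, Set.mem_iUnion, Set.mem_setOf_eq, Finset.mem_coe,
    exists_prop]
  constructor
  · rintro ⟨b, hb, h1, h2⟩; exact ⟨h1, b, hb, h2⟩
  · rintro ⟨h1, b, hb, h2⟩; exact ⟨b, hb, h1, h2⟩

/-- Membership in `E_φ` via `t`: `z` on `D_e`, not a pole of `t`, and `t(z) ∈ B`.
[cite: MochizukiGenEll2010, Thm 2.1 proof p.12, P1ROUTE §4] -/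
theorem mem_Ephi_iff_t {k : ℕ} {B : Finset F} {z : F × F} :
    z ∈ Ephi k B ↔ z.2 ^ (2 * k + 1) = z.1 * (1 - z.1) ∧ z.2 ≠ 0 ∧ 1 - 2 * z.1 ≠ 0 ∧
      ((1 - 2 * z.1) + z.2 ^ (k + 2)) / (z.2 * (1 - 2 * z.1)) ∈ B := by
  rw [mem_Ephi]
  constructor
  · rintro ⟨hz, b, hb, h⟩
    obtain ⟨hr, hs, ht⟩ := (fibre_iff_t k b z hz).mp h
    exact ⟨hz, hr, hs, ht ▸ hb⟩
  · rintro ⟨hz, hr, hs, hB⟩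
    exact ⟨hz, _, hB, (fibre_iff_t k _ z hz).mpr ⟨hr, hs, rfl⟩⟩

/-- `X_φ := x(E_φ) ⊂ F`, the finite set of `x`-coordinates of `E_φ` (GENELLTWO-P1ROUTE §4).
[cite: MochizukiGenEll2010, Thm 2.1 proof p.12, P1ROUTE §4] -/
noncomputable def Xphi (k : ℕ) (B : Finset F) : Finset F :=
  open scoped Classical in (Ephi k B).image Prod.fst

/-- Membership in `X_φ`. [cite: MochizukiGenEll2010, Thm 2.1 proof p.12, P1ROUTE §4] -/
theorem mem_Xphi {k : ℕ} {B : Finset F} {x : F} :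
    x ∈ Xphi k B ↔ ∃ r : F, (x, r) ∈ Ephi k B := by
  classical
  simp [Xphi, Finset.mem_image]

/-- **No cusps in `X_φ`, I**: `0 ∉ X_φ` (`x = 0 ⇒ r = 0 ⇒ D_b = 1 ≠ 0`).
[cite: MochizukiGenEll2010, Thm 2.1 proof p.12 (φ noncritical at the cusps), P1ROUTE §4 («NO cusps»)] -/
theorem zero_not_mem_Xphi (k : ℕ) (B : Finset F) : (0 : F) ∉ Xphi k B := by
  rw [mem_Xphi]
  rintro ⟨r, hr⟩
  obtain ⟨hz, hr0, -, -⟩ := mem_Ephi_iff_t.mp hr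
  have h0 : r ^ (2 * k + 1) = 0 := by simpa using hz
  exact hr0 ((pow_eq_zero_iff (by omega : 2 * k + 1 ≠ 0)).mp h0)

/-- **No cusps in `X_φ`, II**: `1 ∉ X_φ` (`x = 1 ⇒ r = 0`).
[cite: MochizukiGenEll2010, Thm 2.1 proof p.12 (φ noncritical at the cusps), P1ROUTE §4 («NO cusps»)] -/
theorem one_not_mem_Xphi (k : ℕ) (B : Finset F) : (1 : F) ∉ Xphi k B := by
  rw [mem_Xphi]
  rintro ⟨r, hr⟩
  obtain ⟨hz, hr0, -, -⟩ := mem_Ephi_iff_t.mp hr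
  have h0 : r ^ (2 * k + 1) = 0 := by simpa using hz
  exact hr0 ((pow_eq_zero_iff (by omega : 2 * k + 1 ≠ 0)).mp h0)

/-- **Functoriality**: a field homomorphism `φ : F → F'` maps the fibre over `b` into the fibre
over `φ b` and reflects it (the defining conditions are polynomial identities).
[cite: MochizukiGenEll2010, Thm 2.1 proof p.12, P1ROUTE §4] -/
theorem map_mem_fibre_iff {F' : Type w} [Field F'] (φ : F →+* F') (k : ℕ) (b : F) (z : F × F) :
    ((φ z.2) ^ (2 * k + 1) = φ z.1 * (1 - φ z.1) ∧
      (φ z.2) ^ (k + 2) - φ b * (1 - 2 * φ z.1) * φ z.2 + (1 - 2 * φ z.1) = 0) ↔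
    (z.2 ^ (2 * k + 1) = z.1 * (1 - z.1) ∧
      z.2 ^ (k + 2) - b * (1 - 2 * z.1) * z.2 + (1 - 2 * z.1) = 0) := by
  have h1 : (φ z.2) ^ (2 * k + 1) = φ z.1 * (1 - φ z.1) ↔ z.2 ^ (2 * k + 1) = z.1 * (1 - z.1) := by
    rw [← map_pow, ← map_one φ, ← map_sub, ← map_mul, φ.injective.eq_iff]
  have h2 : (φ z.2) ^ (k + 2) - φ b * (1 - 2 * φ z.1) * φ z.2 + (1 - 2 * φ z.1) = 0 ↔
      z.2 ^ (k + 2) - b * (1 - 2 * z.1) * z.2 + (1 - 2 * z.1) = 0 := by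
    rw [← map_eq_zero_iff φ φ.injective]
    simp [map_sub, map_mul, map_pow, map_ofNat]
  rw [h1, h2]

end Fibres

/-! ### Algebraicity: `E_φ` is defined over a number field -/

section Algebraic

variable {K : Type u} [Field K] {F : Type v} [Field F] [Algebra K F]

/-- **Points of the fibre are algebraic.**  If `b ∈ K` and `z = (x, r) ∈ F²` (any field `F ⊇ K`)
lies on `D_e` with `D_b(z) = 0`, then `x` and `r` are algebraic over `K`: `x` is a root of the
NONZERO resultant `Res_Y(curvePoly, fibrePoly b) ∈ K[x]`, and `r^{2k+1} = x(1−x)`.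
[cite: MochizukiGenEll2010, Thm 2.1 proof p.12 (points of U_X(Q̄)), P1ROUTE §4 («X_φ ⊂ U(ℚ̄)»)] -/
theorem isAlgebraic_of_mem_fibre (k : ℕ) (b : K) (z : F × F)
    (hz : z.2 ^ (2 * k + 1) = z.1 * (1 - z.1))
    (hb : z.2 ^ (k + 2) - algebraMap K F b * (1 - 2 * z.1) * z.2 + (1 - 2 * z.1) = 0) :
    IsAlgebraic K z.1 ∧ IsAlgebraic K z.2 := by
  have hx : IsAlgebraic K z.1 := by
    refine ⟨resultant (curvePoly k) (fibrePoly k b), ?_, ?_⟩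
    · exact PlaneCurve.resultant_ne_zero_of_isCoprime_map _ _ (monic_curvePoly k)
        (isCoprime_curvePoly_fibrePoly k b)
    · refine PlaneCurve.aeval_resultant_eq_zero_of_common_zero _ _
        (by rw [natDegree_curvePoly]; omega) z.1 z.2 ?_ ?_
      · rw [eval_curvePoly, sub_eq_zero]; exact hz
      · rw [eval_fibrePoly]; exact hb
  refine ⟨hx, ?_⟩
  have hxi : IsIntegral K z.1 := hx.isIntegral
  have hpow : IsIntegral K (z.2 ^ (2 * k + 1)) := by
    rw [hz]
    exact hxi.mul (isIntegral_one.sub hxi)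
  exact (hpow.of_pow (by omega)).isAlgebraic

/-- **`E_φ` is defined over a finite extension of `K`.**  If `B ⊂ K` (embedded in `F ⊇ K` by
`Finset.map` along the injective `algebraMap`), all
coordinates of the points of `E_φ = t⁻¹(B) ⊂ F²` lie in ONE intermediate field `K'`,
`K ⊆ K' ⊆ F`, finite-dimensional over `K` — a number field when `K` is one.  This is the statement
«`X_φ ⊂ U(ℚ̄)` is a finite set of algebraic points» of the route (it lets W7/W9 transport `E_φ`,
`X_φ` between `ℂ` and the `2`-adic side). [cite: MochizukiGenEll2010, Thm 2.1 proof p.12, P1ROUTE §4] -/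
theorem exists_intermediateField_finiteDimensional (k : ℕ) (B : Finset K) :
    ∃ K' : IntermediateField K F, FiniteDimensional K K' ∧
      ∀ z ∈ Ephi k (B.map ⟨algebraMap K F, (algebraMap K F).injective⟩), z.1 ∈ K' ∧ z.2 ∈ K' := by
  classical
  set E := Ephi k (B.map ⟨algebraMap K F, (algebraMap K F).injective⟩) with hE
  -- the finite set of all coordinates
  let S : Set F := ↑(E.image Prod.fst ∪ E.image Prod.snd)
  haveI : Finite S := (Finset.finite_toSet _).to_subtype
  have hS : ∀ y ∈ S, IsIntegral K y := by
    intro y hy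
    simp only [S, Finset.coe_union, Finset.coe_image, Set.mem_union, Set.mem_image,
      Finset.mem_coe] at hy
    rcases hy with ⟨z, hz, rfl⟩ | ⟨z, hz, rfl⟩
    all_goals
      obtain ⟨hcurve, b', hb', hfib⟩ := mem_Ephi.mp hz
      obtain ⟨b, -, rfl⟩ := Finset.mem_map.mp hb'
      have halg := isAlgebraic_of_mem_fibre k b z hcurve hfib
    · exact halg.1.isIntegral
    · exact halg.2.isIntegral
  refine ⟨IntermediateField.adjoin K S, IntermediateField.finiteDimensional_adjoin hS, ?_⟩
  intro z hz
  constructor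
  · exact IntermediateField.subset_adjoin K S
      (Finset.mem_coe.mpr (Finset.mem_union_left _ (Finset.mem_image_of_mem _ hz)))
  · exact IntermediateField.subset_adjoin K S
      (Finset.mem_coe.mpr (Finset.mem_union_right _ (Finset.mem_image_of_mem _ hz)))

end Algebraic

/-! ### Independence of the algebraically closed field: `E_φ(K̄) ≃ E_φ(F)` -/

section Geometric

variable {K : Type u} [Field K] {Kbar : Type w} [Field Kbar] [Algebra K Kbar] [IsAlgClosed Kbar]
variable {F : Type v} [Field F] [Algebra K F]

/-- An element of `F` algebraic over `K` lies in the range of ANY `K`-algebra map from an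
algebraically closed `K̄` (its minimal polynomial splits in `K̄` and `K`-maps carry root sets onto
root sets: Mathlib `Polynomial.Splits.image_rootSet_of_map_ne_zero`).
[cite: Lang2002, Ch. V §2 Thm 2.8 (extension of embeddings into algebraically closed fields)] -/
theorem mem_range_of_isAlgebraic (φ : Kbar →ₐ[K] F) {y : F} (hy : IsAlgebraic K y) :
    y ∈ Set.range φ := by
  obtain ⟨p, hp0, hpy⟩ := hy
  have hsplit : (p.map (algebraMap K Kbar)).Splits := IsAlgClosed.splits _
  have hne : p.map (algebraMap K F) ≠ 0 := (Polynomial.map_ne_zero_iff (algebraMap K F).injective).mpr hp0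
  have himg := hsplit.image_rootSet_of_map_ne_zero φ hne
  have hy' : y ∈ p.rootSet F := Polynomial.mem_rootSet.mpr ⟨hp0, hpy⟩
  rw [← himg] at hy'
  obtain ⟨x, -, rfl⟩ := hy'
  exact ⟨x, rfl⟩

/-- **`E_φ` does not depend on the algebraically closed field.**  For `B ⊂ K` and any `K`-algebra
map `φ : K̄ → F` from an algebraically closed `K̄` to a field `F` (e.g. `ℚ̄ → ℂ`, `ℚ̄ → ℂ_2`), `φ × φ`
maps `E_φ(K̄) = t⁻¹(B)(K̄)` bijectively onto `E_φ(F)`: as `Finset`s,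
`(Ephi k B_{K̄}).map (φ × φ) = Ephi k B_F`.  So `E_φ`, `X_φ` are ONE finite set of algebraic points,
realised at every place by an embedding (what the W9 cover uses at `∞` and at `2`).
[cite: MochizukiGenEll2010, Thm 2.1 proof p.12 (E ⊂ Y(ℚ̄) viewed in Y(ℚ̄_v), v ∈ V), P1ROUTE §4] -/
theorem map_Ephi_eq (k : ℕ) (B : Finset K) (φ : Kbar →ₐ[K] F) :
    (Ephi k (B.map ⟨algebraMap K Kbar, (algebraMap K Kbar).injective⟩)).map
        ⟨fun w : Kbar × Kbar => (φ w.1, φ w.2),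
          fun _ _ h => Prod.ext (φ.injective (congrArg Prod.fst h))
            (φ.injective (congrArg Prod.snd h))⟩ =
      Ephi k (B.map ⟨algebraMap K F, (algebraMap K F).injective⟩) := by
  ext z
  simp only [Finset.mem_map, Function.Embedding.coeFn_mk, mem_Ephi, Prod.exists]
  constructor
  · rintro ⟨w1, w2, ⟨hcurve, b', hb', hfib⟩, rfl⟩
    obtain ⟨b, hb, rfl⟩ := hb'
    have hmap := (map_mem_fibre_iff (φ : Kbar →+* F) k (algebraMap K Kbar b) (w1, w2)).mpr
      ⟨hcurve, hfib⟩
    rw [AlgHom.coe_toRingHom, AlgHom.commutes] at hmap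
    exact ⟨hmap.1, algebraMap K F b, ⟨b, hb, rfl⟩, hmap.2⟩
  · rintro ⟨hcurve, b', hb', hfib⟩
    obtain ⟨b, hb, rfl⟩ := hb'
    obtain ⟨halg1, halg2⟩ := isAlgebraic_of_mem_fibre k b z hcurve hfib
    obtain ⟨w1, hw1⟩ := mem_range_of_isAlgebraic φ halg1
    obtain ⟨w2, hw2⟩ := mem_range_of_isAlgebraic φ halg2
    refine ⟨w1, w2, ?_, Prod.ext hw1 hw2⟩
    have hmap := (map_mem_fibre_iff (φ : Kbar →+* F) k (algebraMap K Kbar b) (w1, w2)).mp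
    rw [AlgHom.coe_toRingHom, AlgHom.commutes] at hmap
    obtain ⟨h1, h2⟩ := hmap (by simp only [hw1, hw2]; exact ⟨hcurve, hfib⟩)
    exact ⟨h1, algebraMap K Kbar b, ⟨b, hb, rfl⟩, h2⟩

/-- **`X_φ` does not depend on the algebraically closed field**: `φ` maps `X_φ(K̄)` bijectively
onto `X_φ(F)` (`B ⊂ K`). [cite: MochizukiGenEll2010, Thm 2.1 proof p.12, P1ROUTE §4] -/
theorem map_Xphi_eq (k : ℕ) (B : Finset K) (φ : Kbar →ₐ[K] F) :
    (Xphi k (B.map ⟨algebraMap K Kbar, (algebraMap K Kbar).injective⟩)).map ⟨φ, φ.injective⟩ =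
      Xphi k (B.map ⟨algebraMap K F, (algebraMap K F).injective⟩) := by
  ext x
  simp only [Finset.mem_map, Function.Embedding.coeFn_mk, mem_Xphi]
  constructor
  · rintro ⟨x0, ⟨r0, hr0⟩, rfl⟩
    refine ⟨φ r0, ?_⟩
    rw [← map_Ephi_eq k B φ, Finset.mem_map]
    exact ⟨(x0, r0), hr0, rfl⟩
  · rintro ⟨r, hr⟩
    rw [← map_Ephi_eq k B φ, Finset.mem_map] at hr
    obtain ⟨w, hw, hwz⟩ := hr
    exact ⟨w.1, ⟨w.2, hw⟩, congrArg Prod.fst hwz⟩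

/-- Consequently `#E_φ` and `#X_φ` are the same over every algebraically closed field `F ⊇ K`
(computed once over `K̄`). [cite: MochizukiGenEll2010, Thm 2.1 proof p.12, P1ROUTE §4] -/
theorem card_Ephi_eq (k : ℕ) (B : Finset K) (φ : Kbar →ₐ[K] F) :
    (Ephi k (B.map ⟨algebraMap K Kbar, (algebraMap K Kbar).injective⟩)).card =
      (Ephi k (B.map ⟨algebraMap K F, (algebraMap K F).injective⟩)).card := by
  rw [← map_Ephi_eq k B φ, Finset.card_map]

end Geometric

end Literature.NumberTheory.DiophantineGeometry.GenEll.De
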